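import Summits.Parity.BatemanHorn.Theorems.AlmostPrimeZerosDefs
import Literature.NumberTheory.LFunctions.PolynomialRootMertensFirst
import Literature.NumberTheory.Sieve.BatemanHornLocalCounts
import HarnessLib

/-!
# Route `AlmostPrimeZeros`, crux `SystemLSDRealSegment` (stmt-Parity-11292), line
# `beta-thinned-root-kernel`: the registered stub `stub_congruenceFacts`

The two congruence inputs of the line, by name (`RootMertens`, `LocalCounts` of
`Summits/Parity/BatemanHorn/Theorems/AlmostPrimeZerosDefs.lean`), both PROVED in the literature tree:

* `RootMertens g` — Mertens' first theorem for the roots of an irreducible non-constant `g ∈ ℤ[X]`,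
  `|∑_{p ≤ Q} ρ_g(p) log p / p − log Q| ≤ C_g` (Landau 1903):
  `Literature.NumberTheory.LFunctions.DegreeOnePrimes.abs_sum_primesLE_rootCount_mul_log_div_sub_log_le`
  (`Literature/NumberTheory/LFunctions/PolynomialRootMertensFirst.lean`; monic case by partial
  summation from the prime number theorem for the roots, general case via the integral normalization);
* `LocalCounts k f` — for a Bateman–Horn system and all large primes `p`: `p ∤ lc fᵢ`, no common
  root of `fᵢ, fⱼ` modulo `p` (resultants, Bateman–Horn 1962 p. 364), and the Hensel count
  `#{n < p² : p² ∣ fᵢ(n)} ≤ deg fᵢ`: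
  `Literature.NumberTheory.Sieve.IsBatemanHornSystem.exists_localCounts`
  (`Literature/NumberTheory/Sieve/BatemanHornLocalCounts.lean`).
-/

namespace Summit.Parity.BatemanHorn.Cruxes.SystemLSDRealSegment.BetaThinnedRootKernel

open Polynomial

/-- **stub_congruenceFacts** (registered stub of the checked skeleton of line
`beta-thinned-root-kernel`): (1) Mertens' first theorem for the root counts of every irreducible
non-constant `g ∈ ℤ[X]` (Landau 1903); (2) the local counts of every Bateman–Horn system at all
large primes (leading coefficients, no common roots modulo `p`, Hensel count modulo `p²`).
[folklore] -/
theorem stub_congruenceFacts :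
    (∀ g : ℤ[X], RootMertens g) ∧ (∀ (k : ℕ) (f : Fin k → ℤ[X]), LocalCounts k f) :=
  ⟨fun g hg hd =>
    Literature.NumberTheory.LFunctions.DegreeOnePrimes.abs_sum_primesLE_rootCount_mul_log_div_sub_log_le
      g hg hd,
    fun _ _ hf => hf.exists_localCounts⟩

end Summit.Parity.BatemanHorn.Cruxes.SystemLSDRealSegment.BetaThinnedRootKernel
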